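import Summits.BirchSwinnertonDyer.Rank1Residual.X11b.BDPRouteLocalIndex
import Literature.NumberTheory.EllipticCurves.MordellWeilTheoremProofs
import Mathlib.Data.ZMod.QuotientGroup
import HarnessLib

/-!
# X11b, route p2 — RANK-ONE BOOKKEEPING for the input (d): `[E(K) : p^k E(K)] = p^k`,
# `ord_p [E(K) : ℤP] = ord_p c(P)`, and the `p`-adic exponents `e(Q) + ord_p c(P) ≤ e(P)`
# (plumbing item (iv'))

HONEST FRAMING (cell `b2b-bsdres`, run/shared/lean/b2b/bsd-rank1-residual/, verbatim in every
file): the goal of the cell is to DELETE the COMBINATION-SHAPED residual classes of the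
Birch–Swinnerton-Dyer formula for ALL analytic-rank `≤ 1` elliptic curves over `ℚ` — "full BSD
formula for every rank `≤ 1` curve in class `C`" assembled STRICTLY from published theorems — so
that the rank-`≤ 1` remainder becomes exactly the CONSTRUCTION-SHAPED classes, which are TYPED
(missing-input `Prop`s), NOT attempted. This is not "finishing BSD". Sub-cell
`b2b-bsdres-multr1-p2` (X11b, route p2 = BDP + converse + Kolyvagin; the JSW17 Prop. 3.2.1 "≤"
half (d) `P2SelmerCardBoundAt`); a RESEARCH ROUTE; no claim beyond the stated class; X11b stays
CONSTRUCTION-SHAPED; nothing here changes a label; no named fact is minted (theorems only; no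
`sorry`).

## What is here

The exponent of (d) is written at the Heegner point `P`:
`2((ord_p log_ω P − 1) − ord_p [E(K):ℤP]) + ord_p ∏_{w∣p} c_w`, while the local index
(`BDPRouteLocalIndex`) is computed at a GENERATOR `Q` of `E(K)` modulo torsion (`rank E(K) = 1`,
Gross–Zagier–Kolyvagin). This file is the dictionary `P = c(P)·Q + torsion`:

* §1 (abstract, an additive group `A` with a "coordinate" `c : A →+ ℤ`, `c(Q) = 1`, `ker c` torsion,
  no `p`-torsion, finite torsion): `index_range_zsmul_pow_eq` (**`[A : p^k A] = p^k`**),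
  `padicValNat_index_zmultiples_eq` (**`ord_p [A : ℤP] = ord_p |c(P)|`**), and the existence of such
  a coordinate for a finitely generated `A` of `ℤ`-rank one (`exists_coord_of_finrank_eq_one`, from a
  `ℤ`-basis of `A/A_tors`);
* §2 (the `p`-adic line `G = E(ℚ_p)` under (iv), `x ∈ G` of infinite order): `index_range_nsmul_pow_padic`
  (**`[G : p^k G] = p^k`**), `range_nsmul_sup_range_eq` (`p^kG + im_ι A = p^kG + ℤx` when `im_ι A = ℤx + torsion`),
  and **`exponent_add_padicValNat_le`**: if `[G : p^kG + ℤx] = p^{min(k,e)}` and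
  `[G : p^kG + ℤy] = p^{min(k,e')}` for all `k` with `y = m•x + t`, `t` torsion, then
  `e + ord_p m ≤ e'` (through the `ℤ_p`-coordinate `Ψ` of `ZpLineIndex`: `v(Ψ(p^j x)) = j + v(Ψ x)`).

References: [JetchevSkinnerWan2017] Prop. 3.2.1 and (7.1.5) (arXiv:1512.06894 pp. 10–11, 16);
[Castella2018] proof of Thm. 2.3 (calcul) (arXiv:1704.06608 p. 6); [SilvermanAEC2009] VIII.6
(Mordell–Weil), VII.6.3.
-/

noncomputable section

open scoped Classical

namespace Summit.BirchSwinnertonDyer.Rank1Residual.X11b.RankOne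

/-! ## §1. An additive group with an integral coordinate of rank one -/

section Coordinate

variable {A : Type*} [AddCommGroup A] {p : ℕ} [Fact p.Prime]

/-- `nA` as the range of `zsmulAddGroupHom (n : ℤ)` is the range of `nsmulAddMonoidHom n`. [folklore] -/
theorem range_zsmulAddGroupHom_natCast (n : ℕ) :
    (zsmulAddGroupHom (n : ℤ) : A →+ A).range = (nsmulAddMonoidHom n : A →+ A).range := by
  apply le_antisymm
  · rintro _ ⟨a, rfl⟩
    exact ⟨a, by rw [nsmulAddMonoidHom_apply, zsmulAddGroupHom_apply, natCast_zsmul]⟩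
  · rintro _ ⟨a, rfl⟩
    exact ⟨a, by rw [nsmulAddMonoidHom_apply, zsmulAddGroupHom_apply, natCast_zsmul]⟩

variable (c : A →+ ℤ) (Q : A) (hQ : c Q = 1) (hker : ∀ x : A, c x = 0 → IsOfFinAddOrder x)

include hQ in
/-- `c` is onto (`c(m • Q) = m`). [folklore] -/
theorem coord_surjective : Function.Surjective c := fun m =>
  ⟨m • Q, by rw [map_zsmul, hQ, smul_eq_mul, mul_one]⟩

include hQ hker in
/-- **`x = c(x) • Q + (torsion)`.** [folklore] -/
theorem isOfFinAddOrder_sub_coord_zsmul (x : A) : IsOfFinAddOrder (x - c x • Q) :=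
  hker _ (by rw [map_sub, map_zsmul, hQ, smul_eq_mul, mul_one, sub_self])

/-- A torsion element has coordinate `0` (`ℤ` is torsion-free). [folklore] -/
theorem coord_eq_zero_of_isOfFinAddOrder {t : A} (ht : IsOfFinAddOrder t) : c t = 0 := by
  obtain ⟨n, hn, hnt⟩ := (isOfFinAddOrder_iff_nsmul_eq_zero).mp ht
  have h : (n : ℤ) * c t = 0 := by
    have h' := congrArg c hnt
    rwa [map_nsmul, map_zero, nsmul_eq_mul] at h'
  rcases mul_eq_zero.mp h with h | h
  · exact absurd h (by exact_mod_cast hn.ne')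
  · exact h

include hQ hker in
/-- **`[A : p^k A] = p^k`** when `A` has no `p`-torsion: `A → ℤ/p^k`, `x ↦ c(x) mod p^k` is onto
with kernel `p^k A` (a torsion element is a `p^k`-th multiple, `mem_range_nsmul_pow_of_isOfFinAddOrder`).
[cite: JetchevSkinnerWan2017, Prop. 3.2.1 (proof, arXiv:1512.06894 p. 10), `E(K)/p^k E(K)` for rank one] -/
theorem index_range_zsmul_pow_eq (hiv : ∀ x : A, p • x = 0 → x = 0) (k : ℕ) :
    ((zsmulAddGroupHom ((p ^ k : ℕ) : ℤ) : A →+ A).range).index = p ^ k := by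
  haveI : NeZero (p ^ k) := ⟨pow_ne_zero _ (Fact.out : p.Prime).ne_zero⟩
  set f : A →+ ZMod (p ^ k) := (Int.castAddHom (ZMod (p ^ k))).comp c with hf
  have hfs : Function.Surjective f :=
    (ZMod.intCast_surjective (n := p ^ k)).comp (coord_surjective c Q hQ)
  have hfker : f.ker = (zsmulAddGroupHom ((p ^ k : ℕ) : ℤ) : A →+ A).range := by
    apply le_antisymm
    · intro x hx
      rw [AddMonoidHom.mem_ker] at hx
      change ((c x : ℤ) : ZMod (p ^ k)) = 0 at hx
      rw [ZMod.intCast_zmod_eq_zero_iff_dvd] at hx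
      obtain ⟨a, ha⟩ := hx
      -- `x = p^k • (a • Q) + t`, `t` torsion, `t ∈ p^k A`
      have ht := isOfFinAddOrder_sub_coord_zsmul c Q hQ hker x
      have htmem := LocalIndex.mem_range_nsmul_pow_of_isOfFinAddOrder hiv k ht
      rw [← range_zsmulAddGroupHom_natCast] at htmem
      have hx' : x = ((p ^ k : ℕ) : ℤ) • (a • Q) + (x - c x • Q) := by
        rw [ha, smul_smul]; abel
      rw [hx']
      exact AddSubgroup.add_mem _ ⟨a • Q, rfl⟩ htmem
    · rintro _ ⟨y, rfl⟩
      rw [AddMonoidHom.mem_ker, zsmulAddGroupHom_apply, map_zsmul, natCast_zsmul, nsmul_eq_mul,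
        ZMod.natCast_self, zero_mul]
  rw [← hfker, AddSubgroup.index_ker, AddMonoidHom.range_eq_top.mpr hfs, AddSubgroup.card_top,
    Nat.card_zmod]

include hQ hker in
/-- **`ord_p [A : ℤP] = ord_p |c(P)|`** (no `p`-torsion, finite torsion `T`):
`[A : ℤP] = [A : ℤP + T]·[ℤP + T : ℤP]`, `ℤP + T = c⁻¹(c(P)ℤ)` has index `|c(P)|`, and
`[ℤP + T : ℤP] = [T : T ∩ ℤP]` divides `#T`, prime to `p`.
[cite: JetchevSkinnerWan2017, Prop. 3.2.1 and (7.1.5) (arXiv:1512.06894 pp. 10, 16), the index `[E(K):ℤP]_p`] -/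
theorem padicValNat_index_zmultiples_eq [Finite (AddCommGroup.torsion A)]
    (hiv : ∀ x : A, p • x = 0 → x = 0) (P : A) (hP : c P ≠ 0) :
    padicValNat p (AddSubgroup.zmultiples P).index = padicValNat p (c P).natAbs := by
  set H := AddSubgroup.zmultiples P with hH
  set T := AddCommGroup.torsion A with hT
  -- `H ⊔ T = c⁻¹(c(P) ℤ)`
  have hsup : H ⊔ T = (AddSubgroup.zmultiples (c P)).comap c := by
    apply le_antisymm
    · refine sup_le ?_ ?_
      · rw [hH, AddSubgroup.zmultiples_le, AddSubgroup.mem_comap]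
        exact AddSubgroup.mem_zmultiples _
      · intro t ht
        have hct : c t = 0 := coord_eq_zero_of_isOfFinAddOrder c ((AddCommGroup.mem_torsion _).mp ht)
        rw [AddSubgroup.mem_comap, hct]
        exact AddSubgroup.zero_mem _
    · intro x hx
      rw [AddSubgroup.mem_comap, AddSubgroup.mem_zmultiples_iff] at hx
      obtain ⟨m, hm⟩ := hx
      rw [AddSubgroup.mem_sup]
      refine ⟨m • P, ?_, x - m • P, ?_, add_sub_cancel _ _⟩
      · rw [hH]
        exact AddSubgroup.zsmul_mem _ (AddSubgroup.mem_zmultiples P) m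
      · rw [hT, AddCommGroup.mem_torsion]
        exact hker _ (by rw [map_sub, map_zsmul, hm, sub_self])
  have hidx : (H ⊔ T).index = (c P).natAbs := by
    rw [hsup, AddSubgroup.index_comap_of_surjective _ (coord_surjective c Q hQ), Int.index_zmultiples]
  have hrel : H.relIndex (H ⊔ T) * (H ⊔ T).index = H.index :=
    AddSubgroup.relIndex_mul_index le_sup_left
  have hrel' : H.relIndex (H ⊔ T) = H.relIndex T := AddSubgroup.relIndex_sup_left _ _
  -- `[ℤP + T : ℤP] = [T : T ∩ ℤP]` divides `#T`, prime to `p`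
  have hdvd : H.relIndex T ∣ Nat.card T := AddSubgroup.index_dvd_card _
  have hpT : ¬ p ∣ Nat.card T := LocalIndex.not_dvd_card_torsion hiv
  have hrel0 : H.relIndex T ≠ 0 := AddSubgroup.FiniteIndex.index_ne_zero
  have hprel : padicValNat p (H.relIndex T) = 0 :=
    padicValNat.eq_zero_of_not_dvd fun h => hpT (h.trans hdvd)
  rw [← hrel, hrel', hidx, padicValNat.mul hrel0 (Int.natAbs_ne_zero.mpr hP), hprel, zero_add]

end Coordinate

/-! ### A coordinate for `E(K)` of rank one (Mordell–Weil + a `ℤ`-basis of `E(K)/E(K)_tors`) -/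

section MordellWeil

open WeierstrassCurve

variable {K : Type*} [Field K] [NumberField K] (E : WeierstrassCurve K) [E.IsElliptic]

/-- **`rank E(K) = 1 ⟹` a coordinate `c : E(K) →+ ℤ` with `c(Q) = 1` and `ker c` torsion**
(`E(K)` is finitely generated — the tree's Mordell–Weil theorem `module_finite_point_holds` — and
`E(K)/E(K)_tors` is free of rank one, `module_free_mordellWeilModTorsion`,
`finrank_mordellWeilModTorsion_eq_holds`). [cite: SilvermanAEC2009, Thm. VIII.6.7 and §VIII.6] -/
theorem exists_coord_of_mordellWeilRank_eq_one (h : E.mordellWeilRank = 1) :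
    ∃ (c : E.toAffine.Point →+ ℤ) (Q : E.toAffine.Point), c Q = 1 ∧
      ∀ x : E.toAffine.Point, c x = 0 → IsOfFinAddOrder x := by
  haveI : Module.Finite ℤ E.toAffine.Point := E.module_finite_point_holds
  haveI := E.module_free_mordellWeilModTorsion E.module_finite_point_holds
  have h1 : Module.finrank ℤ (mordellWeilModTorsion E) = 1 := by
    rw [E.finrank_mordellWeilModTorsion_eq_holds]; exact h
  let b := Module.basisUnique Unit h1
  let π : E.toAffine.Point →+ mordellWeilModTorsion E :=
    QuotientAddGroup.mk' (AddCommGroup.torsion E.toAffine.Point)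
  obtain ⟨Q, hQ⟩ := QuotientAddGroup.mk'_surjective (AddCommGroup.torsion E.toAffine.Point) (b ())
  refine ⟨(b.coord ()).toAddMonoidHom.comp π, Q, ?_, fun x hx => ?_⟩
  · change b.repr (π Q) () = 1
    rw [hQ, b.repr_self, Finsupp.single_eq_same]
  · change b.repr (π x) () = 0 at hx
    have hsum := b.sum_repr (π x)
    rw [Fintype.sum_unique, show (default : Unit) = () from rfl, hx, zero_smul] at hsum
    have hx0 : π x = 0 := hsum.symm
    exact (AddCommGroup.mem_torsion _).mp ((QuotientAddGroup.eq_zero_iff x).mp hx0)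

end MordellWeil

/-! ## §2. The `p`-adic side: `G = E(ℚ_p)` under (iv) -/

section Padic

open WeierstrassCurve LocalIndex

variable {p : ℕ} [Fact p.Prime] (X : WeierstrassCurve ℚ_[p]) [X.IsIntegral ℤ_[p]] [X.IsElliptic]
  (hiv : ∀ R : X.toAffine.Point, p • R = 0 → R = 0)

include hiv in
/-- **`[E(ℚ_p) : p^k E(ℚ_p)] = p^k`** under (iv) (`E(ℚ_p) ≅ ℤ_p ⊕ T`, `p ∤ #T`): the index formula of
`ZpLineIndex` at `p^k • x` for any `x` of infinite order. [cite: JetchevSkinnerWan2017, (7.1.5) (arXiv:1512.06894 p. 16)]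
[cite: SilvermanAEC2009, VII.6.3] -/
theorem index_range_nsmul_pow_padic (x : X.toAffine.Point) (hx : ¬ IsOfFinAddOrder x) (k : ℕ) :
    ((nsmulAddMonoidHom (p ^ k) : X.toAffine.Point →+ _).range).index = p ^ k := by
  haveI := X.finiteIndex_formalFiltration 2
  obtain ⟨φ, -⟩ := exists_formalFiltration_two_addEquiv X
  have hxk : ¬ IsOfFinAddOrder (p ^ k • x) := fun h =>
    hx (h.of_nsmul (pow_ne_zero _ (Fact.out : p.Prime).ne_zero))
  have h := index_range_nsmul_sup_zmultiples_eq (X.formalFiltration 2) φ hiv (p ^ k • x) hxk k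
  have hmem : p ^ k • x ∈ (nsmulAddMonoidHom (p ^ k) : X.toAffine.Point →+ _).range := ⟨x, rfl⟩
  rw [sup_eq_left.mpr (AddSubgroup.zmultiples_le.mpr hmem)] at h
  rw [h]
  have hpsi0 : psi (X.formalFiltration 2) φ x ≠ 0 := fun h0 =>
    hx ((psi_eq_zero_iff _ φ x).mp h0)
  have hv : (psi (X.formalFiltration 2) φ (p ^ k • x)).valuation =
      k + (psi (X.formalFiltration 2) φ x).valuation := by
    rw [map_nsmul, nsmul_eq_mul, Nat.cast_pow, PadicInt.valuation_p_pow_mul _ _ hpsi0]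
  rw [hv, min_eq_left (Nat.le_add_right k _)]

include hiv in
/-- The exponent `e` in `[G : p^kG + ℤx] = p^{min(k,e)}` (all `k`) is the valuation of the
`ℤ_p`-coordinate `Ψ(x)`. [folklore] -/
theorem exponent_eq_valuation_psi [(X.formalFiltration 2).FiniteIndex]
    (φ : X.formalFiltration 2 ≃+ ℤ_[p]) (x : X.toAffine.Point)
    (hx : ¬ IsOfFinAddOrder x) {e : ℕ}
    (he : ∀ k, ((nsmulAddMonoidHom (p ^ k) : X.toAffine.Point →+ _).range ⊔
      AddSubgroup.zmultiples x).index = p ^ min k e) :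
    e = (psi (X.formalFiltration 2) φ x).valuation := by
  set v := (psi (X.formalFiltration 2) φ x).valuation with hv
  have h1 := he (v + e + 1)
  rw [index_range_nsmul_sup_zmultiples_eq (X.formalFiltration 2) φ hiv x hx (v + e + 1)] at h1
  have h2 := Nat.pow_right_injective (Fact.out : p.Prime).two_le h1
  rw [min_eq_right (by omega), min_eq_right (by omega)] at h2
  exact h2.symm

include hiv in
/-- **`e(x) + ord_p m ≤ e(y)` for `y = m • x + t`, `t` torsion**: `p^kG + ℤy ⊆ p^kG + ℤ(p^j x)`
(`j = ord_p m`, `t ∈ p^kG`), and `[G : p^kG + ℤ p^j x] = p^{min(k, j + e(x))}` (`Ψ(p^j x) = p^j Ψ(x)`).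
Read with `x = Q_ι`, `y = P_ι`, `P = [E(K):ℤP]/#tors · Q + torsion`: the local index at the Heegner
point exceeds the one at the generator by `ord_p [E(K) : ℤP]` — the `ord_p[E(K):ℤP]` of Cas18
(3.2.1) / JSW (7.1.5). [cite: Castella2018, proof of Thm. 2.3, (3.2.1)–(calcul) (arXiv:1704.06608 p. 6)]
[cite: JetchevSkinnerWan2017, (7.1.5) (arXiv:1512.06894 p. 16)] -/
theorem exponent_add_padicValNat_le {x y t : X.toAffine.Point} (hx : ¬ IsOfFinAddOrder x)
    (ht : IsOfFinAddOrder t) {m : ℤ} (hyx : y = m • x + t) {e e' : ℕ}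
    (he : ∀ k, ((nsmulAddMonoidHom (p ^ k) : X.toAffine.Point →+ _).range ⊔
      AddSubgroup.zmultiples x).index = p ^ min k e)
    (he' : ∀ k, ((nsmulAddMonoidHom (p ^ k) : X.toAffine.Point →+ _).range ⊔
      AddSubgroup.zmultiples y).index = p ^ min k e') :
    e + padicValNat p m.natAbs ≤ e' := by
  haveI := X.finiteIndex_formalFiltration 2
  obtain ⟨φ, -⟩ := exists_formalFiltration_two_addEquiv X
  set j := padicValNat p m.natAbs with hj
  have hev : e = (psi (X.formalFiltration 2) φ x).valuation :=
    exponent_eq_valuation_psi X hiv φ x hx he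
  -- `m = p^j m'`
  have hdvd : ((p ^ j : ℕ) : ℤ) ∣ m := Int.ofNat_dvd_left.mpr pow_padicValNat_dvd
  obtain ⟨m', hm'⟩ := hdvd
  set x' : X.toAffine.Point := p ^ j • x with hx'def
  have hx' : ¬ IsOfFinAddOrder x' := fun h =>
    hx (h.of_nsmul (pow_ne_zero _ (Fact.out : p.Prime).ne_zero))
  have hpsi0 : psi (X.formalFiltration 2) φ x ≠ 0 := fun h0 => hx ((psi_eq_zero_iff _ φ x).mp h0)
  -- `p^kG + ℤy ≤ p^kG + ℤx'`
  have hle : ∀ k, (nsmulAddMonoidHom (p ^ k) : X.toAffine.Point →+ _).range ⊔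
      AddSubgroup.zmultiples y ≤
        (nsmulAddMonoidHom (p ^ k) : X.toAffine.Point →+ _).range ⊔ AddSubgroup.zmultiples x' := by
    intro k
    refine sup_le le_sup_left ?_
    rw [AddSubgroup.zmultiples_le, hyx]
    refine AddSubgroup.add_mem _ (AddSubgroup.mem_sup_right ?_)
      (AddSubgroup.mem_sup_left (mem_range_nsmul_pow_of_isOfFinAddOrder hiv k ht))
    rw [AddSubgroup.mem_zmultiples_iff]
    refine ⟨m', ?_⟩
    rw [hx'def, hm', mul_comm, mul_zsmul, natCast_zsmul]
  -- compare indices at `k = j + e`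
  have h1 : ((nsmulAddMonoidHom (p ^ (j + e)) : X.toAffine.Point →+ _).range ⊔
      AddSubgroup.zmultiples x').index = p ^ (j + e) := by
    rw [index_range_nsmul_sup_zmultiples_eq (X.formalFiltration 2) φ hiv x' hx' (j + e)]
    have hv : (psi (X.formalFiltration 2) φ x').valuation =
        j + (psi (X.formalFiltration 2) φ x).valuation := by
      rw [hx'def, map_nsmul, nsmul_eq_mul, Nat.cast_pow, PadicInt.valuation_p_pow_mul _ _ hpsi0]
    rw [hv, ← hev, min_self]
  have h2 := AddSubgroup.index_dvd_of_le (hle (j + e))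
  rw [h1, he' (j + e), Nat.pow_dvd_pow_iff_le_right (Fact.out : p.Prime).one_lt] at h2
  have h3 : j + e ≤ e' := le_trans h2 (min_le_right _ _) |> fun h => by omega
  omega

omit [X.IsIntegral ℤ_[p]] [X.IsElliptic] in
/-- **`p^kG + im_ι A = p^kG + ℤ x`** when the image of `A` is `ℤx + (torsion)`: for an additive map
`f : A → G`, a coordinate `c` on `A` with `a − c(a)•Q` torsion for all `a`, and `x = f(Q)`.
[folklore] -/
theorem range_nsmul_sup_range_eq {A : Type*} [AddCommGroup A] (f : A →+ X.toAffine.Point)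
    (c : A →+ ℤ) (Q : A) (hA : ∀ a : A, IsOfFinAddOrder (a - c a • Q)) (k : ℕ)
    (hiv : ∀ R : X.toAffine.Point, p • R = 0 → R = 0) :
    (nsmulAddMonoidHom (p ^ k) : X.toAffine.Point →+ _).range ⊔ f.range =
      (nsmulAddMonoidHom (p ^ k) : X.toAffine.Point →+ _).range ⊔ AddSubgroup.zmultiples (f Q) := by
  apply le_antisymm
  · refine sup_le le_sup_left ?_
    rintro _ ⟨a, rfl⟩
    have ha : f a = c a • f Q + f (a - c a • Q) := by
      rw [map_sub, map_zsmul]; abel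
    rw [ha]
    refine AddSubgroup.add_mem _ (AddSubgroup.mem_sup_right ?_)
      (AddSubgroup.mem_sup_left (mem_range_nsmul_pow_of_isOfFinAddOrder hiv k (f.isOfFinAddOrder (hA a))))
    exact AddSubgroup.zsmul_mem _ (AddSubgroup.mem_zmultiples _) _
  · refine sup_le le_sup_left ?_
    rw [AddSubgroup.zmultiples_le]
    exact AddSubgroup.mem_sup_right ⟨Q, rfl⟩

end Padic

end Summit.BirchSwinnertonDyer.Rank1Residual.X11b.RankOne

end
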